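import Mathlib
import Literature.Analysis.FluidPDE.VectorCalculus
import Literature.Analysis.FluidPDE.SelfSimilarEulerProfile
import Literature.Analysis.FluidPDE.SelfSimilarEulerOutgoingExclusionTools
import Summits.NavierStokesRegularity.NavierStokesRegularity.Theorems.EulerZoomLiouvillePowerGaugeEulerLiouvilleCondenserGradientRiccati
import Summits.NavierStokesRegularity.NavierStokesRegularity.Theorems.EulerZoomLiouvillePowerGaugeEulerLiouvilleNeedleStagnationKinematics

/-!
# R52 plate t55-FLUXc: the BERNOULLI-WEIGHTED FLUX LAW (nsreg-p2 ROUND-52 «PROVENANCE» §C, `NsregP2.R52.BernoulliWeightedFluxLaw γ`;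
# texts and proofs VERBATIM from `r52/Sketch52.lean` (v1.2/v1.3, nsreg-p2 g42 — authorship of the proofs: nsreg-p2 g42); seat ns-ezl-w2 g6,
# `--supports stmt-NavierStokesRegularity-19832 --as helper`)

For a `C²` self-similar Euler profile and every `χ ∈ C¹(ℝ)`: `div(χ(ℋ)·W)(y) = 3γ·χ(ℋ(y)) + (2γ−1)·χ′(ℋ(y))·‖W(y)‖²`
(`W = γ(y−c)+U` the wind, `ℋ` the self-similar Bernoulli function; product rule, `tr DW = 3γ`, `tr(ℓ ⊗ W) = ℓ(W)`, and the transport identity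
`Dℋ[W] = (2γ−1)‖W‖²`, CIV (3.31)).  For `χ′ ≥ 0`, `γ ≤ ½` the right side is `≤ 3γχ(ℋ)`: «the spine is source-fed».
`divergence_bernoulliWeight_transport` (centre `0`) and `bernoulliWeightedFluxLaw γ` (every centre; statement = the Prop
`NsregP2.R52.BernoulliWeightedFluxLaw γ` δ-unfolded, so `example : BernoulliWeightedFluxLaw γ := bernoulliWeightedFluxLaw γ` closes by `exact`).

HONEST FRAMING: an exact class-free identity for hypothetical profiles (ROUND-52 instrument); nothing about the crux E (19832 OPEN) or NS
regularity. [cite: ConstantinIgnatovaVicol2026Putative, §3.4.3 eq. (3.31)] [folklore]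
-/

noncomputable section

set_option linter.dupNamespace false

open MeasureTheory Set Filter Topology Metric Function TopologicalSpace
open scoped ENNReal NNReal RealInnerProductSpace

namespace Summit.NavierStokesRegularity.NavierStokesRegularity.Theorems.PowerGaugeEulerLiouville

open Literature.Analysis Literature.Analysis.FluidPDE

namespace ClassicalProfile

/-- **BERNOULLI-WEIGHTED FLUX LAW, centre `0` (exact, PROVED).**  For a `C²` self-similar Euler profile with centre `0` and any `χ ∈ C¹(ℝ)`:
`div(χ(ℋ)·W)(y) = 3γ·χ(ℋ(y)) + (2γ−1)·χ′(ℋ(y))·‖W(y)‖²` — product rule `D(χ(ℋ)W) = χ(ℋ)DW + (χ′(ℋ)Dℋ) ⊗ W`, `tr DW = 3γ`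
(tree `Stagnation.trace_fderiv_selfSimilarTransport`, `div U = 0`), `tr(ℓ ⊗ W) = ℓ(W)` (`LinearMap.trace_smulRight`) and the transport identity
`Dℋ[W] = (2γ−1)‖W‖²` (`IsSelfSimilarEulerProfile.fderiv_selfSimilarBernoulli_transport`, CIV (3.31)).
[nsreg-p2 R52 §C; cite: ConstantinIgnatovaVicol2026Putative, §3.4.3 eq. (3.31)] -/
theorem divergence_bernoulliWeight_transport {γ : ℝ} {U : (EuclideanSpace ℝ (Fin 3)) → (EuclideanSpace ℝ (Fin 3))} {P : (EuclideanSpace ℝ (Fin 3)) → ℝ}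
    (hprof : IsSelfSimilarEulerProfile γ 0 U P) {χ : ℝ → ℝ} (hχ : ContDiff ℝ 1 χ) (y : (EuclideanSpace ℝ (Fin 3))) :
    VectorCalculus.divergence (fun x => χ (selfSimilarBernoulli γ 0 U P x) • selfSimilarTransport γ 0 U x) y =
      3 * γ * χ (selfSimilarBernoulli γ 0 U P y) +
        (2 * γ - 1) * deriv χ (selfSimilarBernoulli γ 0 U P y) * ‖selfSimilarTransport γ 0 U y‖ ^ 2 := by
  have hUd : Differentiable ℝ U := hprof.differentiable_velocity
  have hW : HasFDerivAt (selfSimilarTransport γ 0 U) (γ • ContinuousLinearMap.id ℝ (EuclideanSpace ℝ (Fin 3)) + fderiv ℝ U y) y :=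
    Condenser.hasFDerivAt_selfSimilarTransport_zero hUd y
  have hHd : Differentiable ℝ (selfSimilarBernoulli γ 0 U P) :=
    hprof.contDiff_selfSimilarBernoulli.differentiable one_ne_zero
  have hχd : HasDerivAt χ (deriv χ (selfSimilarBernoulli γ 0 U P y)) (selfSimilarBernoulli γ 0 U P y) :=
    ((hχ.differentiable one_ne_zero) _).hasDerivAt
  have hf : HasFDerivAt (fun x => χ (selfSimilarBernoulli γ 0 U P x))
      (deriv χ (selfSimilarBernoulli γ 0 U P y) • fderiv ℝ (selfSimilarBernoulli γ 0 U P) y) y :=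
    hχd.comp_hasFDerivAt y (hHd y).hasFDerivAt
  have hprod := hf.smul hW
  have htr := Stagnation.trace_fderiv_selfSimilarTransport (γ := γ) (hUd y) (hprof.divFree y)
  rw [hW.fderiv] at htr
  have hfun : (fun x => χ (selfSimilarBernoulli γ 0 U P x) • selfSimilarTransport γ 0 U x) =
      ((fun x => χ (selfSimilarBernoulli γ 0 U P x)) • selfSimilarTransport γ 0 U) := rfl
  unfold VectorCalculus.divergence
  rw [hfun, hprod.fderiv, ContinuousLinearMap.toLinearMap_add, map_add, ContinuousLinearMap.toLinearMap_smul, map_smul, htr]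
  have hsr : (((deriv χ (selfSimilarBernoulli γ 0 U P y) • fderiv ℝ (selfSimilarBernoulli γ 0 U P) y).smulRight
        (selfSimilarTransport γ 0 U y) : (EuclideanSpace ℝ (Fin 3)) →L[ℝ] (EuclideanSpace ℝ (Fin 3))) : (EuclideanSpace ℝ (Fin 3)) →ₗ[ℝ] (EuclideanSpace ℝ (Fin 3))) =
      ((deriv χ (selfSimilarBernoulli γ 0 U P y) • fderiv ℝ (selfSimilarBernoulli γ 0 U P) y : (EuclideanSpace ℝ (Fin 3)) →L[ℝ] ℝ) :
        (EuclideanSpace ℝ (Fin 3)) →ₗ[ℝ] ℝ).smulRight (selfSimilarTransport γ 0 U y) := rfl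
  rw [hsr, LinearMap.trace_smulRight, ContinuousLinearMap.coe_coe, _root_.smul_apply,
    hprof.fderiv_selfSimilarBernoulli_transport y, smul_eq_mul, smul_eq_mul]
  ring


/-- **THE FLUX LAW FOR A GENERAL CENTRE, PROVED** (plate t55-FLUXc becomes a verbatim copy): same three ingredients, with `DW(y) = γ·id + DU(y)` for
`W = γ(y − c) + U` and `tr DW = 3γ` computed inline. [nsreg-p2 R52 §C; cite: ConstantinIgnatovaVicol2026Putative, §3.4.3 eq. (3.31)] -/
theorem bernoulliWeightedFluxLaw (γ : ℝ) :
    ∀ (c : (EuclideanSpace ℝ (Fin 3))) (U : (EuclideanSpace ℝ (Fin 3)) → (EuclideanSpace ℝ (Fin 3))) (P : (EuclideanSpace ℝ (Fin 3)) → ℝ), IsSelfSimilarEulerProfile γ c U P →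
    ∀ χ : ℝ → ℝ, ContDiff ℝ 1 χ →
      ∀ y : (EuclideanSpace ℝ (Fin 3)),
        VectorCalculus.divergence (fun x => χ (selfSimilarBernoulli γ c U P x) • selfSimilarTransport γ c U x) y =
          3 * γ * χ (selfSimilarBernoulli γ c U P y) +
            (2 * γ - 1) * deriv χ (selfSimilarBernoulli γ c U P y) * ‖selfSimilarTransport γ c U y‖ ^ 2 := by
  intro c U P hprof χ hχ y
  have hUd : Differentiable ℝ U := hprof.differentiable_velocity
  have hW : HasFDerivAt (selfSimilarTransport γ c U) (γ • ContinuousLinearMap.id ℝ (EuclideanSpace ℝ (Fin 3)) + fderiv ℝ U y) y := by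
    have h : HasFDerivAt (fun z : (EuclideanSpace ℝ (Fin 3)) => γ • (z - c) + U z) (γ • ContinuousLinearMap.id ℝ (EuclideanSpace ℝ (Fin 3)) + fderiv ℝ U y) y :=
      (((hasFDerivAt_id y).sub_const c).fun_const_smul γ).fun_add (hUd y).hasFDerivAt
    have e : selfSimilarTransport γ c U = fun z : (EuclideanSpace ℝ (Fin 3)) => γ • (z - c) + U z := by
      funext z; rw [selfSimilarTransport_apply]
    rw [e]; exact h
  have hHd : Differentiable ℝ (selfSimilarBernoulli γ c U P) :=
    hprof.contDiff_selfSimilarBernoulli.differentiable one_ne_zero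
  have hχd : HasDerivAt χ (deriv χ (selfSimilarBernoulli γ c U P y)) (selfSimilarBernoulli γ c U P y) :=
    ((hχ.differentiable one_ne_zero) _).hasDerivAt
  have hf : HasFDerivAt (fun x => χ (selfSimilarBernoulli γ c U P x))
      (deriv χ (selfSimilarBernoulli γ c U P y) • fderiv ℝ (selfSimilarBernoulli γ c U P) y) y :=
    hχd.comp_hasFDerivAt y (hHd y).hasFDerivAt
  have hprod := hf.smul hW
  have htrU : LinearMap.trace ℝ (EuclideanSpace ℝ (Fin 3)) ((fderiv ℝ U y : (EuclideanSpace ℝ (Fin 3)) →L[ℝ] (EuclideanSpace ℝ (Fin 3))) : (EuclideanSpace ℝ (Fin 3)) →ₗ[ℝ] (EuclideanSpace ℝ (Fin 3))) = 0 := hprof.divFree y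
  have htr : LinearMap.trace ℝ (EuclideanSpace ℝ (Fin 3)) ((γ • ContinuousLinearMap.id ℝ (EuclideanSpace ℝ (Fin 3)) + fderiv ℝ U y : (EuclideanSpace ℝ (Fin 3)) →L[ℝ] (EuclideanSpace ℝ (Fin 3))) : (EuclideanSpace ℝ (Fin 3)) →ₗ[ℝ] (EuclideanSpace ℝ (Fin 3))) = 3 * γ := by
    rw [ContinuousLinearMap.toLinearMap_add, ContinuousLinearMap.toLinearMap_smul, map_add, map_smul, htrU, add_zero,
      ContinuousLinearMap.coe_id, LinearMap.trace_id, finrank_euclideanSpace_fin]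
    simp [mul_comm]
  have hfun : (fun x => χ (selfSimilarBernoulli γ c U P x) • selfSimilarTransport γ c U x) =
      ((fun x => χ (selfSimilarBernoulli γ c U P x)) • selfSimilarTransport γ c U) := rfl
  unfold VectorCalculus.divergence
  rw [hfun, hprod.fderiv, ContinuousLinearMap.toLinearMap_add, map_add, ContinuousLinearMap.toLinearMap_smul, map_smul, htr]
  have hsr : (((deriv χ (selfSimilarBernoulli γ c U P y) • fderiv ℝ (selfSimilarBernoulli γ c U P) y).smulRight
        (selfSimilarTransport γ c U y) : (EuclideanSpace ℝ (Fin 3)) →L[ℝ] (EuclideanSpace ℝ (Fin 3))) : (EuclideanSpace ℝ (Fin 3)) →ₗ[ℝ] (EuclideanSpace ℝ (Fin 3))) =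
      ((deriv χ (selfSimilarBernoulli γ c U P y) • fderiv ℝ (selfSimilarBernoulli γ c U P) y : (EuclideanSpace ℝ (Fin 3)) →L[ℝ] ℝ) :
        (EuclideanSpace ℝ (Fin 3)) →ₗ[ℝ] ℝ).smulRight (selfSimilarTransport γ c U y) := rfl
  rw [hsr, LinearMap.trace_smulRight, ContinuousLinearMap.coe_coe, _root_.smul_apply,
    hprof.fderiv_selfSimilarBernoulli_transport y, smul_eq_mul, smul_eq_mul]
  ring


end ClassicalProfile

end Summit.NavierStokesRegularity.NavierStokesRegularity.Theorems.PowerGaugeEulerLiouville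

end
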